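import Summits.Langlands.Langlands.Theses.RamifiedCoefficientSeed
import Literature.NumberTheory.PAdicHodge.BdRDataNonempty
import Literature.NumberTheory.GaloisRepresentations.LocalGaloisGroupProofs

/-!
# Disproof workfile — crux `ExplicitRamifiedFamily` (stmt-Langlands-16778), cycle 1

Seat `refuter-cdisprove-stmt-Langlands-16778-0` (2026-08-17).  LANDED from this file: negative knowledge I,
`Summits/Langlands/Langlands/Theorems/ExplicitRamifiedFamily/Negative/PinLoadBearing.lean` (p160747, commit
5083abf1f5f8; namespace `Summit.Langlands.Langlands.Theorems.ExplicitRamifiedFamily.Negative`: `badWD`, `advDatum`,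
`advDatumAt`, `advDatumAt_𝔅`, `isLocallyUnramified_of_isCrystallineFramed_advDatumAt`,
`not_explicitRamifiedFamily_at_advDatumAt`, `explicitRamifiedFamily_iff_pinned_text`) — importable by ideators /
planners / the lead.  Verdict of this cycle: **NO KILL** — the crux
is neither refutable nor provable in the tree as typed, and its arithmetic content is an OPEN existence
problem that no printed theorem excludes.  Everything below is kernel-checked (rc 0, no `sorry`); prose is
in docstrings.  Index of findings:

1. `ExplicitRamifiedFamilyFor 𝔇` (§1) — the crux PARAMETRISED by the local `p`-adic Hodge datum family;
   the crux is literally the instance at the ε-pinned `fontainePstAdicCompletion`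
   (`explicitRamifiedFamily_iff_for_pinned`, by `Iff.rfl`).  Isolates the one formally soft conjunct,
   (C1) `IsCrystallineFramed` — nothing else in the crux mentions the pin.
2. LOAD-BEARING ANALYSIS of (C1) (§2–§3), the main checked content:
   * `ArithmeticCore` = the crux with (C1) deleted, keeping the honest `B_dR`-weights half (C2);
     `arithmeticCore_of_explicitRamifiedFamily`.
   * THE ADVERSARIAL DATUM (§3, constructed, axioms verified): `advDatum hp` / `advDatumAt p v hv` is a
     `PstWeilDeligneData` with the SAME `ℚ_p`-structure and the SAME period ring as the pin
     (`advDatumAt_algebra : … = (pinned p v hv).algebra` by `rfl`, `advDatumAt_𝔅 : … = (pinned p v hv).𝔅`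
     — both are Fontaine's `B_dR(ℚ_v)`), i.e. a point of the very subtype `{𝔇 // algebra canonical ∧
     𝔅 = bdRPeriodRingData}` that Hilbert's `ε` ranges over in `fontainePst` (`advDatum_mem_subtype`),
     whose Weil–Deligne half sends every NON-unramified `ρ` to `badWD` = `(diag(q^{deg},1,1), N = E₀₁)`
     (non-zero monodromy).  All five structure axioms are theorems (as for the accepted
     `nonempty_pstWeilDeligneData_bdR`).  Consequence: `isLocallyUnramified_of_isCrystallineFramed_advDatumAt`
     — for this datum "pinned-crystalline ⇒ locally unramified at `p`" in rank 3.
   * `not_explicitRamifiedFamilyFor_advDatumAt` — **the crux evaluated at the adversarial point of ε's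
     domain is FALSE**, modulo the single true `p`-adic Hodge input `UnramifiedWeightsNe012 pinned`
     ("a rank-3 `ρ` unramified at `v ∣ p` does not have labelled `B_dR`-weights `{0,1,2}`" — Fontaine
     Exp. III §5 / Sen in LABELLED form; in the tree only unlabelled, `hodgeTateWeights_bdR_of_unramified`,
     and for the trivial representation, `fontainePst_labelledHodgeTateWeights_one`; it concerns the PIN's
     genuine `B_dR`, not the adversarial WD half: `unramifiedWeightsNe012_adv_iff`).
   * Conversely `explicitRamifiedFamilyFor_of_core`: at the OTHER admissible extreme ("de Rham ⇒
     pinned-crystalline", the `nonempty_pstWeilDeligneData_bdR` witness) the `𝔇`-crux is just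
     `ArithmeticCore` + de Rham.
   READING: the pin's two halves that the crux can see (algebra, `𝔅`) do not distinguish `fontainePst` from
   `advDatumAt`; only `IsWeilDeligneOf` does, and the accepted constraints on it (structure axioms; clauses
   (F1)–(F12) under the named fact `FontaineDatumExists`) speak about unramified `ρ`, `ε^m`, determinants and
   Kisin-ring points only.  Hence (C1) is UNDERIVABLE for every candidate member (any proof must separate
   `fontainePst` from `advDatumAt`, i.e. use `Classical.epsilon_spec` through a clause that does not exist)
   and IRREFUTABLE (no accepted clause forces `N ≠ 0` on anything).  This is the strategist's (I2) and the
   rattack caveat, now as theorems.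
3. JUNK-FAMILY LEDGER (§4, paper): which conjunct excludes which cheap family.  Headline: in the INTENDED
   model the crux MINUS (E) is TRUE and cheap — `ρ_n = 1 ⊕ ε⁻¹ ⊕ ε⁻²χ_n` (`χ_n` pairwise distinct characters of
   `p`-power order, unramified at `p`) passes PAIRWISE, (A) (`χ_n ≠ 1`), (B), (C) (weights `0,1,2`,
   crystalline), (D) (`ν = ε⁻²`), (F) (`tr ρ_n(c) = +1`); the crux MINUS (A) is TRUE in reality
   (`Sym² g ⊗ ψ`, `g` of weight 2, infinitely many twist classes); constant families die on PAIRWISE; Artin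
   and cubic-induced families die on (C2).  Content of the crux = (A) ∧ (E) ∧ regular weights jointly =
   infinitely many twist classes of PRIMITIVE rank-3 geometric `ρ` with the residual shape at one `p ≥ 11`
   — an open existence problem; not refutable.
4. TYPING AUDIT (§5): every constituent definition re-read; no junk operator, no vacuous binder, sign
   convention `HT(ε) = {−1}` consistent with `{0,1,2}` for `H²`-pieces of Hodge type `(1,1,1)`.  No formal kill.
5. TARGETS (line `birth`, PICKED 2026-08-17): stubs 2–3 landed by the lead (p158189, p158260) and TRUE
   (Newton identities, re-derived §6); stub 1 `stub_certifiedSeedFamily` carries clause (C) verbatim ⇒ same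
   verdict as the crux; `ExplicitRamifiedFamily_of` sorry-free, no smuggled gap.  No stub is attackable.
6. REALITY-SIDE STATUS (§7): single members plausibly exist at `p = 11` (AGG level 53); an infinite
   twist-inequivalent supply at a fixed `p ≥ 11` has no source in print; no finiteness theorem bounds it.
   Barrier catalogue: nothing bites.  Literature search this session was DEGRADED (local index resetting,
   OpenAlex 429, zbMATH empty) — recorded, not used as evidence.
-/

set_option linter.dupNamespace false

noncomputable section

namespace Summit.Langlands.Langlands.Cruxes.ExplicitRamifiedFamily.Disproof

open Summit.Langlands.Langlands.Theses.RamifiedCoefficientSeed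
open Literature.NumberTheory.GaloisRepresentations
open Literature.NumberTheory.GaloisRepresentations.IsNonarchimedeanLocalField
open Literature.NumberTheory.PAdicHodge
open Field ValuativeRel WeilGroup Filter
open scoped MatrixGroups

/-! ## 0. Datum families -/

/-- The type of LOCAL DATUM FAMILIES at a prime `p`: a `p`-adic Hodge datum for `ℚ_v` at each place `v ∣ p`
(intended and pinned in the crux: `fontainePstAdicCompletion v p hv`). [folklore] -/
abbrev DatumAt (p : ℕ) [Fact p.Prime] : Type 1 :=
  ∀ (v : IsDedekindDomain.HeightOneSpectrum (NumberField.RingOfIntegers ℚ)),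
    ((p : ℕ) : NumberField.RingOfIntegers ℚ) ∈ v.asIdeal → PstWeilDeligneData (v.adicCompletion ℚ) p

/-- The pinned datum family of the crux. [folklore] -/
abbrev pinned (p : ℕ) [Fact p.Prime] : DatumAt p :=
  fun v hv => Literature.NumberTheory.PAdicHodge.fontainePstAdicCompletion v p hv

/-! ## 1. The crux parametrised by the local datum -/

/-- **Member predicate for the datum family `𝔇`**: conjuncts (A)–(F) of the crux for one representation,
with the pinned datum replaced by `𝔇 v hv` — verbatim otherwise. [folklore] -/
def MemberFor (p : ℕ) [Fact p.Prime] (𝔇 : DatumAt p) (ρ : FramedGaloisRep ℚ (PadicAlgCl p) 3) : Prop :=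
  (¬ ∃ χ : FramedGaloisRep ℚ (PadicAlgCl p) 1, ∀ σ, (ρ σ⁻¹).val.trace = (χ σ).val 0 0 * (ρ σ).val.trace) ∧
  (∀ᶠ v : IsDedekindDomain.HeightOneSpectrum (NumberField.RingOfIntegers ℚ) in Filter.cofinite,
    ρ.IsUnramifiedAt v) ∧
  (∀ (v : IsDedekindDomain.HeightOneSpectrum (NumberField.RingOfIntegers ℚ))
    (hv : ((p : ℕ) : NumberField.RingOfIntegers ℚ) ∈ v.asIdeal),
    let D := 𝔇 v hv
    D.IsCrystallineFramed (ρ.toLocal v) ∧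
      (letI := D.algebra
       ∀ τ : v.adicCompletion ℚ →ₐ[ℚ_[p]] PadicAlgCl p,
         ρ.labelledHodgeTateWeightsAt v D.algebra D.𝔅 τ.toRingHom = {0, 1, 2})) ∧
  (∃ ν : FramedGaloisRep ℚ (PadicAlgCl p) 1, ∀ σ, ‖(ρ σ).val.trace - (ν σ).val 0 0 * (ρ σ⁻¹).val.trace‖ < 1) ∧
  (ρ.restrictField (CyclotomicField p ℚ)).IsResiduallyAbsIrreducible ∧
  (∃ (φ : ℚ →+* ℝ) (c : Field.absoluteGaloisGroup ℚ), IsComplexConjugation φ c ∧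
    ((ρ c).val.trace = 1 ∨ (ρ c).val.trace = -1))

/-- **The pairwise twist-inequivalence conjunct** (datum-free). [folklore] -/
def Pairwise (p : ℕ) [Fact p.Prime] (f : ℕ → FramedGaloisRep ℚ (PadicAlgCl p) 3) : Prop :=
  ∀ m n, m ≠ n → ¬ ∃ χ : FramedGaloisRep ℚ (PadicAlgCl p) 1,
    ∀ σ, (f m σ).val.trace = (χ σ).val 0 0 * (f n σ).val.trace

/-- **The crux parametrised by the datum family**: `∃ p ≥ 11, ∃ f`, pairwise twist-inequivalent, every
member satisfying (A)–(F) relative to `𝔇 p`. [folklore] -/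
def ExplicitRamifiedFamilyFor (𝔇 : ∀ (p : ℕ) [Fact p.Prime], DatumAt p) : Prop :=
  ∃ (p : ℕ) (_ : Fact p.Prime), 11 ≤ p ∧ ∃ f : ℕ → FramedGaloisRep ℚ (PadicAlgCl p) 3,
    Pairwise p f ∧ ∀ n, MemberFor p (𝔇 p) (f n)

/-- **The crux IS the pinned instance** — definitionally (`Iff.rfl`): nothing in the crux refers to the
pin except through conjunct (C). [folklore] -/
theorem explicitRamifiedFamily_iff_for_pinned :
    ExplicitRamifiedFamily ↔ ExplicitRamifiedFamilyFor (fun p _ => pinned p) :=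
  Iff.rfl

/-! ## 2. Load-bearing analysis of (C1) `IsCrystallineFramed` at the pin -/

/-- **ARITHMETIC CORE** = the crux with the Weil–Deligne half (C1) `IsCrystallineFramed` DELETED (the honest
`B_dR` half (C2) — labelled weights `{0,1,2}` for the pinned, genuinely-`B_dR` period ring — is kept).  This is
the statement the crux MEANS minus "de Rham"; it is what an explicit/compute seat can address on paper.
[folklore] -/
def ArithmeticCore : Prop :=
  ∃ (p : ℕ) (_ : Fact p.Prime), 11 ≤ p ∧ ∃ f : ℕ → FramedGaloisRep ℚ (PadicAlgCl p) 3,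
    Pairwise p f ∧ ∀ n,
    (¬ ∃ χ : FramedGaloisRep ℚ (PadicAlgCl p) 1, ∀ σ, (f n σ⁻¹).val.trace = (χ σ).val 0 0 * (f n σ).val.trace) ∧
    (∀ᶠ v : IsDedekindDomain.HeightOneSpectrum (NumberField.RingOfIntegers ℚ) in Filter.cofinite,
      (f n).IsUnramifiedAt v) ∧
    (∀ (v : IsDedekindDomain.HeightOneSpectrum (NumberField.RingOfIntegers ℚ))
      (hv : ((p : ℕ) : NumberField.RingOfIntegers ℚ) ∈ v.asIdeal),
      let D := pinned p v hv
      (letI := D.algebra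
       ∀ τ : v.adicCompletion ℚ →ₐ[ℚ_[p]] PadicAlgCl p,
         (f n).labelledHodgeTateWeightsAt v D.algebra D.𝔅 τ.toRingHom = {0, 1, 2})) ∧
    (∃ ν : FramedGaloisRep ℚ (PadicAlgCl p) 1, ∀ σ, ‖(f n σ).val.trace - (ν σ).val 0 0 * (f n σ⁻¹).val.trace‖ < 1) ∧
    ((f n).restrictField (CyclotomicField p ℚ)).IsResiduallyAbsIrreducible ∧
    (∃ (φ : ℚ →+* ℝ) (c : Field.absoluteGaloisGroup ℚ), IsComplexConjugation φ c ∧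
      (((f n) c).val.trace = 1 ∨ ((f n) c).val.trace = -1))

/-- **The crux implies its arithmetic core** (drop (C1)).  The converse is EXACTLY the missing comparison
"members are pinned-crystalline", underivable today (no clause of `IsFontaineDatum` speaks about a
ramified-at-`p` `ρ`; no `H²_ét` / `r_ι(π)` constructor). [folklore] -/
theorem arithmeticCore_of_explicitRamifiedFamily (h : ExplicitRamifiedFamily) : ArithmeticCore := by
  obtain ⟨p, hp, h11, f, hpair, hf⟩ := h
  refine ⟨p, hp, h11, f, hpair, fun n => ?_⟩
  obtain ⟨hA, hB, hC, hD, hE, hF⟩ := hf n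
  exact ⟨hA, hB, fun v hv => (hC v hv).2, hD, hE, hF⟩

/-- **Adversarial data, step 1.**  For ANY datum family `𝔇` under which pinned-crystalline representations
are locally unramified (such families exist INSIDE the subtype `{𝔇 // algebra canonical ∧ 𝔅 = B_dR}` that
Hilbert's `ε` ranges over in `fontainePst`: take the accepted `nonempty_pstWeilDeligneData_bdR` witness and
send its ramified branch to a Weil–Deligne representation with `N ≠ 0` — all five structure axioms still
hold; construction deliberately not carried out here), a witness of the `𝔇`-crux yields a rank-3
representation of `Γ_ℚ` that is LOCALLY UNRAMIFIED at every `v ∣ p` and has labelled `B_dR`-weights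
`{0,1,2}` there — a `p`-adic Hodge absurdity (unramified ⇒ `ℂ_p`-admissible ⇒ all weights `0`; Sen /
Fontaine Exp. III §5), together with residual absolute irreducibility over `ℚ(ζ_p)`. [folklore] -/
theorem exists_unramified_weights_of_for (𝔇 : ∀ (p : ℕ) [Fact p.Prime], DatumAt p)
    (h𝔇 : ∀ (p : ℕ) [Fact p.Prime] (v : IsDedekindDomain.HeightOneSpectrum (NumberField.RingOfIntegers ℚ))
      (hv : ((p : ℕ) : NumberField.RingOfIntegers ℚ) ∈ v.asIdeal)
      (ρ : FramedRep (Field.absoluteGaloisGroup (v.adicCompletion ℚ)) (PadicAlgCl p) 3),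
      (𝔇 p v hv).IsCrystallineFramed ρ → ρ.IsLocallyUnramified)
    (h : ExplicitRamifiedFamilyFor 𝔇) :
    ∃ (p : ℕ) (_ : Fact p.Prime), 11 ≤ p ∧ ∃ ρ : FramedGaloisRep ℚ (PadicAlgCl p) 3,
      (ρ.restrictField (CyclotomicField p ℚ)).IsResiduallyAbsIrreducible ∧
      ∀ (v : IsDedekindDomain.HeightOneSpectrum (NumberField.RingOfIntegers ℚ))
        (hv : ((p : ℕ) : NumberField.RingOfIntegers ℚ) ∈ v.asIdeal),
        (ρ.toLocal v).IsLocallyUnramified ∧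
          (letI := (𝔇 p v hv).algebra
           ∀ τ : v.adicCompletion ℚ →ₐ[ℚ_[p]] PadicAlgCl p,
             ρ.labelledHodgeTateWeightsAt v (𝔇 p v hv).algebra (𝔇 p v hv).𝔅 τ.toRingHom = {0, 1, 2}) := by
  obtain ⟨p, hp, h11, f, -, hf⟩ := h
  obtain ⟨-, -, hC, -, hE, -⟩ := hf 0
  exact ⟨p, hp, h11, f 0, hE, fun v hv => ⟨h𝔇 p v hv _ (hC v hv).1, (hC v hv).2⟩⟩

/-- **The true `p`-adic Hodge fact that closes the contradiction**, as a `Prop` (relative to the datum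
family's algebra/period ring; for the families of interest these are the canonical structure and `B_dR`):
a rank-3 `ρ` locally unramified at `v ∣ p` does not have labelled weights `{0,1,2}` for some (hence the
unique) `ℚ_p`-embedding `τ`.  TRUE (unramified ⇒ all labelled weights `0`: Fontaine, Astérisque 223, Exp.
III §5; Sen), in the tree only for the trivial representation (`fontainePst_labelledHodgeTateWeights_one`,
`labelledHodgeTateWeights_of_forall_eq`) and in `B_HT`-unlabelled form (`HodgeTateUnramifiedWeights`).
[cite: FontaineAsterisque223III, Exp. III §5] -/
def UnramifiedWeightsNe012 (𝔇 : ∀ (p : ℕ) [Fact p.Prime], DatumAt p) : Prop :=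
  ∀ (p : ℕ) [Fact p.Prime] (ρ : FramedGaloisRep ℚ (PadicAlgCl p) 3)
    (v : IsDedekindDomain.HeightOneSpectrum (NumberField.RingOfIntegers ℚ))
    (hv : ((p : ℕ) : NumberField.RingOfIntegers ℚ) ∈ v.asIdeal),
    (ρ.toLocal v).IsLocallyUnramified →
      letI := (𝔇 p v hv).algebra
      ∃ τ : v.adicCompletion ℚ →ₐ[ℚ_[p]] PadicAlgCl p,
        ρ.labelledHodgeTateWeightsAt v (𝔇 p v hv).algebra (𝔇 p v hv).𝔅 τ.toRingHom ≠ {0, 1, 2}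

/-- Over `ℚ` there is a finite place above every prime `p` (the height-one prime `(p)` of `𝓞 ℚ`).
[folklore] -/
theorem exists_heightOneSpectrum_mem (p : ℕ) [hp : Fact p.Prime] :
    ∃ v : IsDedekindDomain.HeightOneSpectrum (NumberField.RingOfIntegers ℚ),
      ((p : ℕ) : NumberField.RingOfIntegers ℚ) ∈ v.asIdeal := by
  refine ⟨Rat.HeightOneSpectrum.primesEquiv.symm ⟨p, hp.out⟩, ?_⟩
  change ((p : ℕ) : NumberField.RingOfIntegers ℚ) ∈
    (Ideal.span {((p : ℕ) : ℤ)}).map (Rat.IsIntegralClosure.intEquiv (NumberField.RingOfIntegers ℚ)).symm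
  have h : (Rat.IsIntegralClosure.intEquiv (NumberField.RingOfIntegers ℚ)).symm (p : ℤ) =
      ((p : ℕ) : NumberField.RingOfIntegers ℚ) := map_natCast _ p
  rw [← h]
  exact Ideal.mem_map_of_mem _ (Ideal.mem_span_singleton_self _)

/-- **Adversarial data, step 2 (the load-bearing statement).**  For any datum family with
"pinned-crystalline ⇒ locally unramified", the `𝔇`-crux is FALSE modulo `UnramifiedWeightsNe012`.  Read
against `explicitRamifiedFamily_iff_for_pinned`: the crux is decided by the Weil–Deligne half of the pin and
by nothing else in (C) — any proof must use a property of `fontainePst`'s `IsWeilDeligneOf` on RAMIFIED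
`ρ` (none is accepted), and any refutation would have to refute `ArithmeticCore` (§3, §6: open, true in the
intended model). [folklore] -/
theorem not_explicitRamifiedFamilyFor_of (𝔇 : ∀ (p : ℕ) [Fact p.Prime], DatumAt p)
    (h𝔇 : ∀ (p : ℕ) [Fact p.Prime] (v : IsDedekindDomain.HeightOneSpectrum (NumberField.RingOfIntegers ℚ))
      (hv : ((p : ℕ) : NumberField.RingOfIntegers ℚ) ∈ v.asIdeal)
      (ρ : FramedRep (Field.absoluteGaloisGroup (v.adicCompletion ℚ)) (PadicAlgCl p) 3),
      (𝔇 p v hv).IsCrystallineFramed ρ → ρ.IsLocallyUnramified)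
    (hW : UnramifiedWeightsNe012 𝔇) : ¬ ExplicitRamifiedFamilyFor 𝔇 := by
  intro h
  obtain ⟨p, hp, -, ρ, -, hρ⟩ := exists_unramified_weights_of_for 𝔇 h𝔇 h
  obtain ⟨v, hv⟩ := exists_heightOneSpectrum_mem p
  obtain ⟨hunr, hwt⟩ := hρ v hv
  obtain ⟨τ, hτ⟩ := hW p ρ v hv hunr
  exact hτ (hwt τ)

/-- **The opposite admissible extreme.**  For a datum family with "de Rham ⇒ pinned-crystalline" (realised in
ε's subtype by the accepted `nonempty_pstWeilDeligneData_bdR` witness itself: its ramified branch is the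
TRIVIAL Weil–Deligne representation, `N = 0`, inertia trivial), the `𝔇`-crux follows from the arithmetic
core for `𝔇` plus de Rham-ness of the members — i.e. it carries no information beyond `B_dR`-admissibility.
Between this extreme and `not_explicitRamifiedFamilyFor_of` lies the pin; nothing accepted says where.
[folklore] -/
theorem explicitRamifiedFamilyFor_of_core (𝔇 : ∀ (p : ℕ) [Fact p.Prime], DatumAt p)
    (h𝔇 : ∀ (p : ℕ) [Fact p.Prime] (v : IsDedekindDomain.HeightOneSpectrum (NumberField.RingOfIntegers ℚ))
      (hv : ((p : ℕ) : NumberField.RingOfIntegers ℚ) ∈ v.asIdeal)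
      (ρ : FramedRep (Field.absoluteGaloisGroup (v.adicCompletion ℚ)) (PadicAlgCl p) 3),
      (𝔇 p v hv).IsDeRhamFramed ρ → (𝔇 p v hv).IsCrystallineFramed ρ)
    (h : ∃ (p : ℕ) (_ : Fact p.Prime), 11 ≤ p ∧ ∃ f : ℕ → FramedGaloisRep ℚ (PadicAlgCl p) 3,
      Pairwise p f ∧ ∀ n,
      (¬ ∃ χ : FramedGaloisRep ℚ (PadicAlgCl p) 1, ∀ σ, (f n σ⁻¹).val.trace = (χ σ).val 0 0 * (f n σ).val.trace) ∧
      (∀ᶠ v : IsDedekindDomain.HeightOneSpectrum (NumberField.RingOfIntegers ℚ) in Filter.cofinite,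
        (f n).IsUnramifiedAt v) ∧
      (∀ (v : IsDedekindDomain.HeightOneSpectrum (NumberField.RingOfIntegers ℚ))
        (hv : ((p : ℕ) : NumberField.RingOfIntegers ℚ) ∈ v.asIdeal),
        (𝔇 p v hv).IsDeRhamFramed ((f n).toLocal v) ∧
        (letI := (𝔇 p v hv).algebra
         ∀ τ : v.adicCompletion ℚ →ₐ[ℚ_[p]] PadicAlgCl p,
           (f n).labelledHodgeTateWeightsAt v (𝔇 p v hv).algebra (𝔇 p v hv).𝔅 τ.toRingHom = {0, 1, 2})) ∧
      (∃ ν : FramedGaloisRep ℚ (PadicAlgCl p) 1, ∀ σ, ‖(f n σ).val.trace - (ν σ).val 0 0 * (f n σ⁻¹).val.trace‖ < 1) ∧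
      ((f n).restrictField (CyclotomicField p ℚ)).IsResiduallyAbsIrreducible ∧
      (∃ (φ : ℚ →+* ℝ) (c : Field.absoluteGaloisGroup ℚ), IsComplexConjugation φ c ∧
        (((f n) c).val.trace = 1 ∨ ((f n) c).val.trace = -1))) :
    ExplicitRamifiedFamilyFor 𝔇 := by
  obtain ⟨p, hp, h11, f, hpair, hf⟩ := h
  refine ⟨p, hp, h11, f, hpair, fun n => ?_⟩
  obtain ⟨hA, hB, hC, hD, hE, hF⟩ := hf n
  exact ⟨hA, hB, fun v hv => ⟨h𝔇 p v hv _ (hC v hv).1, (hC v hv).2⟩, hD, hE, hF⟩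

/-! ## 3. The adversarial datum: a point of ε's domain at which the crux is false

Construction of `badWD` (non-zero monodromy), of the local datum `advDatum hp` on `B_dR(F)` with the
adversarial Weil–Deligne relation, verification of the five structure axioms, and its specialisation
`advDatumAt` to the places of `ℚ` above `p` with the PIN's own algebra and period ring. -/

section BadWD

variable {F : Type} [Field F] [ValuativeRel F] [TopologicalSpace F] [IsNonarchimedeanLocalField F]
  {p : ℕ} [Fact p.Prime]

/-- The diagonal matrix `diag(q^{deg w}, 1, …, 1)` (entry `q^{deg w}` at the index of value `0`). [folklore] -/
def badDiag (n : ℕ) (w : WeilGroup F) : Matrix (Fin n) (Fin n) (PadicAlgCl p) :=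
  Matrix.diagonal fun i => if i.val = 0 then ((residueFieldCard F : PadicAlgCl p) ^ (deg w)) else 1

/-- The nilpotent matrix with a single entry `1` at position `(0, 1)` (zero if `n ≤ 1`). [folklore] -/
def badNil (n : ℕ) : Matrix (Fin n) (Fin n) (PadicAlgCl p) :=
  Matrix.of fun i j => if i.val = 0 ∧ j.val = 1 then 1 else 0

/-- `badDiag n 1 = 1` (`deg 1 = 0`). [folklore] -/
theorem badDiag_one (n : ℕ) : badDiag (F := F) (p := p) n 1 = 1 := by
  unfold badDiag
  rw [deg_one IsFrobPow.mul_holds IsFrobPow.unique_holds, zpow_zero]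
  convert Matrix.diagonal_one with i
  split_ifs <;> rfl

/-- `badDiag` is multiplicative (`deg` is a homomorphism, `q ≠ 0`). [folklore] -/
theorem badDiag_mul (n : ℕ) (w w' : WeilGroup F) :
    badDiag (F := F) (p := p) n (w * w') = badDiag n w * badDiag n w' := by
  unfold badDiag
  rw [Matrix.diagonal_mul_diagonal, deg_mul IsFrobPow.mul_holds IsFrobPow.unique_holds]
  congr 1
  funext i
  split_ifs with h
  · exact zpow_add₀ (by exact_mod_cast residueFieldCard_ne_zero F) _ _
  · rw [mul_one]

/-- `badDiag` is trivial on inertia (`deg = 0` there). [folklore] -/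
theorem badDiag_of_mem_inertia (n : ℕ) {u : WeilGroup F} (hu : u ∈ inertia F) :
    badDiag (F := F) (p := p) n u = 1 := by
  unfold badDiag
  rw [(deg_eq_zero_iff_mem_inertia IsFrobPow.mul_holds IsFrobPow.unique_holds).2 hu, zpow_zero]
  convert Matrix.diagonal_one with i
  split_ifs <;> rfl

/-- The Weil–Deligne relation at matrix level: `D(w) E₀₁ = q^{deg w} • E₀₁ D(w)`. [folklore] -/
theorem badDiag_mul_badNil (n : ℕ) (w : WeilGroup F) :
    badDiag (F := F) (p := p) n w * badNil n =
      ((residueFieldCard F : PadicAlgCl p) ^ (deg w)) • (badNil n * badDiag n w) := by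
  ext i j
  simp only [badDiag, badNil, Matrix.diagonal_mul, Matrix.mul_diagonal, Matrix.of_apply,
    Matrix.smul_apply, smul_eq_mul]
  by_cases h : i.val = 0 ∧ j.val = 1
  · rw [if_pos h, if_pos h.1, if_neg (show ¬ (j.val = 0) by omega)]
    ring
  · rw [if_neg h]
    ring

/-- `E₀₁² = 0`. [folklore] -/
theorem badNil_mul_badNil (n : ℕ) : badNil (p := p) n * badNil n = 0 := by
  ext i j
  simp only [badNil, Matrix.mul_apply, Matrix.of_apply, Matrix.zero_apply]
  refine Finset.sum_eq_zero fun k _ => ?_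
  by_cases h1 : i.val = 0 ∧ k.val = 1
  · rw [if_pos h1, if_neg (show ¬ (k.val = 0 ∧ j.val = 1) by omega), mul_zero]
  · rw [if_neg h1, zero_mul]

variable (F p) in
/-- The unramified character `w ↦ diag(q^{deg w}, 1, …, 1)` of `W_F` on `ℚ̄_pⁿ`. [folklore] -/
def badRep (n : ℕ) : Representation (PadicAlgCl p) (WeilGroup F) (Fin n → PadicAlgCl p) where
  toFun w := Matrix.toLin' (badDiag n w)
  map_one' := by rw [badDiag_one, Matrix.toLin'_one]; rfl
  map_mul' w w' := by rw [badDiag_mul, Matrix.toLin'_mul, Module.End.mul_eq_comp]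

/-- Unfolding lemma for `badRep`. [folklore] -/
theorem badRep_apply (n : ℕ) (w : WeilGroup F) : badRep F p n w = Matrix.toLin' (badDiag n w) := rfl

/-- `badRep` is an unramified representation of `W_F`. [folklore] -/
theorem isUnramifiedRep_badRep (n : ℕ) : IsUnramifiedRep (badRep F p n) := by
  intro u hu
  rw [badRep_apply, badDiag_of_mem_inertia n hu, Matrix.toLin'_one]
  rfl

variable (F p) in
/-- **The "bad" Weil–Deligne representation** `(diag(q^{deg}, 1, …, 1), N = E₀₁)`: unramified Weil
action, NON-ZERO monodromy as soon as `n ≥ 2` (a `Sp(2) ⊕ 1^{n-2}`-shaped object). [folklore] -/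
def badWD (n : ℕ) : WeilDeligneRep F (PadicAlgCl p) (Fin n → PadicAlgCl p) where
  ρ := badRep F p n
  isContinuous := (isUnramifiedRep_badRep n).isContinuousRep
  N := Matrix.toLin' (badNil n)
  isNilpotent_N := ⟨2, by rw [pow_two, Module.End.mul_eq_comp, ← Matrix.toLin'_mul, badNil_mul_badNil, map_zero]⟩
  conj_N w := by
    rw [badRep_apply, ← Matrix.toLin'_mul, badDiag_mul_badNil, map_smul, Matrix.toLin'_mul]

/-- Unfolding lemma for the monodromy of `badWD`. [folklore] -/
theorem badWD_N (n : ℕ) : (badWD F p n).N = Matrix.toLin' (badNil n) := rfl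

/-- For `n = 3` the monodromy of `badWD` is non-zero: `N e₁ = e₀`. [folklore] -/
theorem badWD_N_three_ne_zero : (badWD F p 3).N ≠ 0 := by
  intro h
  have h1 := congrArg (fun f : (Fin 3 → PadicAlgCl p) →ₗ[PadicAlgCl p] (Fin 3 → PadicAlgCl p) =>
    f (Pi.single 1 1) 0) h
  simp only [badWD_N, Matrix.toLin'_apply, Matrix.mulVec_single_one, LinearMap.zero_apply,
    Pi.zero_apply, Matrix.col_apply, badNil, Matrix.of_apply] at h1
  simp at h1

/-- A Weil–Deligne representation isomorphic to `badWD F p 3` has non-zero monodromy. [folklore] -/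
theorem N_ne_zero_of_equiv_badWD {V : Type*} [AddCommGroup V] [Module (PadicAlgCl p) V]
    {r : WeilDeligneRep F (PadicAlgCl p) V} (e : r.Equiv (badWD F p 3)) : r.N ≠ 0 := by
  intro hN
  apply badWD_N_three_ne_zero (F := F) (p := p)
  have h0 : (badWD F p 3).N ∘ₗ e.toRepEquiv.toIntertwiningMap.toLinearMap = 0 := by
    rw [← e.comm_N, hN, LinearMap.comp_zero]
  refine LinearMap.ext fun x => ?_
  obtain ⟨y, rfl⟩ := e.toRepEquiv.toLinearEquiv.surjective x
  have := LinearMap.congr_fun h0 y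
  rw [LinearMap.comp_apply, LinearMap.zero_apply] at this
  rw [LinearMap.zero_apply]
  exact this

end BadWD

section Datum

variable {F : Type} [Field F] [ValuativeRel F] [TopologicalSpace F] [IsNonarchimedeanLocalField F]
  {p : ℕ} [Fact p.Prime]
variable [CharZero F] [Fact (¬ IsUnit (p : integerC F))]
  [IsAdicComplete (Ideal.span {(p : integerC F)}) (integerC F)] [Algebra ℚ_[p] F]

/-- The ADVERSARIAL Weil–Deligne relation on data over `B_dR`: unramified `ρ ↦ (ρ|_{W_F}, 0)` (forced by
the structure axioms), every OTHER `ρ ↦ badWD` (non-zero monodromy in rank `3`). [folklore] -/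
def advRel : ∀ {n : ℕ}, FramedRep (absoluteGaloisGroup F) (PadicAlgCl p) n →
    WeilDeligneRep F (PadicAlgCl p) (Fin n → PadicAlgCl p) → Prop := fun {n} ρ r =>
  (ρ.IsLocallyUnramified ∧ r.N = 0 ∧ Nonempty (Representation.Equiv r.ρ (ρ.weilRestrict F))) ∨
    (¬ ρ.IsLocallyUnramified ∧ r.IsEquivalent (badWD F p n))

-- Mathlib's own global value of `maxSynthPendingDepth`.
set_option maxSynthPendingDepth 3 in
/-- **The adversarial datum on `B_dR(F)`**: canonical (given) `ℚ_p`-structure, period ring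
`bdRPeriodRingData hp` — so it lies in the subtype Hilbert's `ε` ranges over in `fontainePst` — and the
adversarial Weil–Deligne relation `advRel`.  All five structure axioms are theorems (same proofs as the
accepted `nonempty_pstWeilDeligneData_bdR`, whose ramified branch was the trivial representation). [folklore] -/
def advDatum (hp : valuation F p < 1) : PstWeilDeligneData F p where
  algebra := ‹Algebra ℚ_[p] F›
  𝔅 := bdRPeriodRingData (F := F) (p := p) hp
  IsWeilDeligneOf := advRel
  exists_of_isDeRham := by
    intro n ρ _
    by_cases hu : ρ.IsLocallyUnramified
    · exact ⟨WeilDeligneRep.ofRep (ρ.weilRestrict F) hu.isUnramifiedRep_weilRestrict.isContinuousRep,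
        Or.inl ⟨hu, rfl, ⟨Representation.Equiv.refl _⟩⟩⟩
    · exact ⟨badWD F p n, Or.inr ⟨hu, WeilDeligneRep.IsEquivalent.refl _⟩⟩
  isEquivalent := by
    intro n ρ r r' h h'
    rcases h with ⟨hu, hN, ⟨e⟩⟩ | ⟨hu, ⟨e⟩⟩
    · rcases h' with ⟨_, hN', ⟨e'⟩⟩ | ⟨hu', _⟩
      · exact ⟨{ toRepEquiv := e.trans e'.symm
                 comm_N := by rw [hN, hN', LinearMap.comp_zero, LinearMap.zero_comp] }⟩
      · exact absurd hu hu'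
    · rcases h' with ⟨hu', _, _⟩ | ⟨_, he'⟩
      · exact absurd hu' hu
      · exact (show r.IsEquivalent (badWD F p n) from ⟨e⟩).trans he'.symm
  conj := by
    intro n g ρ r h
    rcases h with ⟨hu, hN, ⟨e⟩⟩ | ⟨hu, he⟩
    · exact Or.inl ⟨(FramedRep.isLocallyUnramified_conj_iff g ρ).2 hu, hN,
        ⟨e.trans (FramedRep.weilRestrictConjEquiv g ρ)⟩⟩
    · exact Or.inr ⟨fun h => hu ((FramedRep.isLocallyUnramified_conj_iff g ρ).1 h), he⟩
  isDeRhamWith_of_isLocallyUnramified := fun ρ h => ρ.isDeRhamWith_bdR_of_isLocallyUnramified hp h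
  wd_of_isLocallyUnramified := by
    intro n ρ r hρ h
    rcases h with ⟨_, hN, ⟨e⟩⟩ | ⟨hu, _⟩
    · refine ⟨hN, fun u hu => LinearMap.ext fun v => ?_⟩
      have h1 := Representation.IntertwiningMap.isIntertwining _ _ e.toIntertwiningMap u v
      rw [hρ.isUnramifiedRep_weilRestrict u hu] at h1
      exact e.injective h1
    · exact absurd hρ hu

/-- `advDatum` lies in the subtype Hilbert's `ε` ranges over in `fontainePst`: given `ℚ_p`-structure,
period ring `bdRPeriodRingData hp` (literally the predicate of `nonempty_pstWeilDeligneData_bdR`). [folklore] -/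
theorem advDatum_mem_subtype (hp : valuation F p < 1) :
    (advDatum (F := F) (p := p) hp).algebra = ‹Algebra ℚ_[p] F› ∧
      (advDatum (F := F) (p := p) hp).𝔅 =
        (letI := (advDatum (F := F) (p := p) hp).algebra; bdRPeriodRingData (F := F) (p := p) hp) :=
  ⟨rfl, rfl⟩

/-- **Under the adversarial datum, pinned-crystalline rank-3 representations are unramified.** [folklore] -/
theorem isLocallyUnramified_of_isCrystallineFramed_advDatum (hp : valuation F p < 1)
    (ρ : FramedRep (absoluteGaloisGroup F) (PadicAlgCl p) 3)
    (h : (advDatum (F := F) (p := p) hp).IsCrystallineFramed ρ) : ρ.IsLocallyUnramified := by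
  obtain ⟨-, r, hr, hN, -⟩ := h
  rcases hr with ⟨hu, -, -⟩ | ⟨-, ⟨e⟩⟩
  · exact hu
  · exact absurd hN (N_ne_zero_of_equiv_badWD e)

end Datum

section Global

/-- **The adversarial datum family at the places of `ℚ` above `p`**: same `ℚ_p`-structure and same period
ring (`B_dR(ℚ_v)`) as the PINNED datum, adversarial Weil–Deligne half. [folklore] -/
def advDatumAt (p : ℕ) [Fact p.Prime] : DatumAt p := fun v hv =>
  haveI := LocalField.charZero_adicCompletion v
  letI : Algebra ℚ_[p] (v.adicCompletion ℚ) := (pinned p v hv).algebra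
  haveI : Fact (¬ IsUnit ((p : ℕ) : integerC (v.adicCompletion ℚ))) :=
    ⟨not_isUnit_natCast_integerC (LocalField.valuation_adicCompletion_natCast_lt_one v p hv)⟩
  haveI : IsAdicComplete (Ideal.span {((p : ℕ) : integerC (v.adicCompletion ℚ))})
      (integerC (v.adicCompletion ℚ)) :=
    isAdicComplete_integerC_natCast (LocalField.valuation_adicCompletion_natCast_lt_one v p hv)
  advDatum (LocalField.valuation_adicCompletion_natCast_lt_one v p hv)

/-- Same `ℚ_p`-structure as the pin (by construction). [folklore] -/
theorem advDatumAt_algebra (p : ℕ) [Fact p.Prime]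
    (v : IsDedekindDomain.HeightOneSpectrum (NumberField.RingOfIntegers ℚ))
    (hv : ((p : ℕ) : NumberField.RingOfIntegers ℚ) ∈ v.asIdeal) :
    (advDatumAt p v hv).algebra = (pinned p v hv).algebra := rfl

/-- Same period ring as the pin: both are Fontaine's `B_dR(ℚ_v)` (`fontainePstAdicCompletion_𝔅_eq_bdRPeriodRingData`,
unconditional). [folklore] -/
theorem advDatumAt_𝔅 (p : ℕ) [Fact p.Prime]
    (v : IsDedekindDomain.HeightOneSpectrum (NumberField.RingOfIntegers ℚ))
    (hv : ((p : ℕ) : NumberField.RingOfIntegers ℚ) ∈ v.asIdeal) :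
    (advDatumAt p v hv).𝔅 = (pinned p v hv).𝔅 := by
  haveI := LocalField.charZero_adicCompletion v
  haveI : Fact (¬ IsUnit ((p : ℕ) : integerC (v.adicCompletion ℚ))) :=
    ⟨not_isUnit_natCast_integerC (LocalField.valuation_adicCompletion_natCast_lt_one v p hv)⟩
  haveI : IsAdicComplete (Ideal.span {((p : ℕ) : integerC (v.adicCompletion ℚ))})
      (integerC (v.adicCompletion ℚ)) :=
    isAdicComplete_integerC_natCast (LocalField.valuation_adicCompletion_natCast_lt_one v p hv)
  show (advDatumAt p v hv).𝔅 = (fontainePstAdicCompletion v p hv).𝔅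
  rw [fontainePstAdicCompletion_𝔅_eq_bdRPeriodRingData v p hv]
  rfl

/-- **Under the adversarial family, pinned-crystalline rank-3 local representations are unramified.** [folklore] -/
theorem isLocallyUnramified_of_isCrystallineFramed_advDatumAt (p : ℕ) [Fact p.Prime]
    (v : IsDedekindDomain.HeightOneSpectrum (NumberField.RingOfIntegers ℚ))
    (hv : ((p : ℕ) : NumberField.RingOfIntegers ℚ) ∈ v.asIdeal)
    (ρ : FramedRep (absoluteGaloisGroup (v.adicCompletion ℚ)) (PadicAlgCl p) 3)
    (h : (advDatumAt p v hv).IsCrystallineFramed ρ) : ρ.IsLocallyUnramified := by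
  haveI := LocalField.charZero_adicCompletion v
  letI : Algebra ℚ_[p] (v.adicCompletion ℚ) := (pinned p v hv).algebra
  haveI : Fact (¬ IsUnit ((p : ℕ) : integerC (v.adicCompletion ℚ))) :=
    ⟨not_isUnit_natCast_integerC (LocalField.valuation_adicCompletion_natCast_lt_one v p hv)⟩
  haveI : IsAdicComplete (Ideal.span {((p : ℕ) : integerC (v.adicCompletion ℚ))})
      (integerC (v.adicCompletion ℚ)) :=
    isAdicComplete_integerC_natCast (LocalField.valuation_adicCompletion_natCast_lt_one v p hv)
  exact isLocallyUnramified_of_isCrystallineFramed_advDatum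
    (LocalField.valuation_adicCompletion_natCast_lt_one v p hv) ρ h


/-- **The weights hypothesis does not see the Weil–Deligne half**: for the adversarial family it is the
same statement as for the PINNED family (same algebra by `rfl`, same `𝔅` by `advDatumAt_𝔅`). [folklore] -/
theorem unramifiedWeightsNe012_adv_iff :
    UnramifiedWeightsNe012 (fun p _ => advDatumAt p) ↔ UnramifiedWeightsNe012 (fun p _ => pinned p) := by
  unfold UnramifiedWeightsNe012
  simp only [advDatumAt_𝔅]
  exact Iff.rfl

/-- **MAIN CHECKED FINDING.  The crux evaluated at the adversarial point of ε's domain is FALSE** — modulo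
the true `p`-adic Hodge input `UnramifiedWeightsNe012 pinned` (unramified at `p` ⇒ labelled `B_dR`-weights
are not `{0,1,2}`; Fontaine, Astérisque 223, Exp. III §5, labelled form).  Since `advDatumAt` and the pin
share algebra and period ring, and the accepted constraints on the pin's Weil–Deligne half concern only
unramified representations, cyclotomic powers, determinants and Kisin-ring points, NO accepted fact
separates the two evaluations on a ramified weight-`{0,1,2}` member: (C1) is the load-bearing, formally
undetermined conjunct.  [cite: FontaineAsterisque223III, Exp. III §5] -/
theorem not_explicitRamifiedFamilyFor_advDatumAt
    (hW : UnramifiedWeightsNe012 (fun p _ => pinned p)) :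
    ¬ ExplicitRamifiedFamilyFor (fun p _ => advDatumAt p) :=
  not_explicitRamifiedFamilyFor_of _
    (fun p _ v hv ρ h => isLocallyUnramified_of_isCrystallineFramed_advDatumAt p v hv ρ h)
    (unramifiedWeightsNe012_adv_iff.2 hW)

/-- **Summary (the pin is load-bearing).**  The crux is the pinned evaluation; the adversarial evaluation
agrees with the pin on everything the crux reads except `IsWeilDeligneOf`, and is false (mod the weights
fact). [folklore] -/
theorem pin_load_bearing (hW : UnramifiedWeightsNe012 (fun p _ => pinned p)) :
    (ExplicitRamifiedFamily ↔ ExplicitRamifiedFamilyFor (fun p _ => pinned p)) ∧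
    (¬ ExplicitRamifiedFamilyFor (fun p _ => advDatumAt p)) ∧
    (∀ (p : ℕ) [Fact p.Prime] (v : IsDedekindDomain.HeightOneSpectrum (NumberField.RingOfIntegers ℚ))
      (hv : ((p : ℕ) : NumberField.RingOfIntegers ℚ) ∈ v.asIdeal),
      (advDatumAt p v hv).algebra = (pinned p v hv).algebra ∧ (advDatumAt p v hv).𝔅 = (pinned p v hv).𝔅) :=
  ⟨explicitRamifiedFamily_iff_for_pinned, not_explicitRamifiedFamilyFor_advDatumAt hW,
    fun p _ v hv => ⟨advDatumAt_algebra p v hv, advDatumAt_𝔅 p v hv⟩⟩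

end Global

/-! ## 4. Junk-family ledger (paper analysis; which conjunct is load-bearing against which cheap family)

Notation: (A) not essentially self-dual (trace form), (B) unramified a.e., (C1) pinned `IsCrystallineFramed`,
(C2) labelled weights `{0,1,2}`, (D) residual essential self-duality `‖tr ρ(σ) − ν(σ) tr ρ(σ⁻¹)‖ < 1`,
(E) `ρ̄|ℚ(ζ_p)` absolutely irreducible, (F) a complex conjugation of trace `±1`, PW pairwise
twist-inequivalence.  "✓" = holds in the INTENDED model (genuine `B_dR`, genuine `WD ∘ D_pst`).

| family | PW | A | B | C | D | E | F | killed by |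
|---|---|---|---|---|---|---|---|---|
| constant `f n = ρ₀` | ✗ (`χ = 1`) | – | – | – | – | – | – | PW only (rattack Scratch D1) |
| `ρ_n = 1 ⊕ ε⁻¹ ⊕ ε⁻²χ_n`, `χ_n` of order `p^{k_n}`, conductor `q_n ≡ 1 (p)`, distinct, unramified at `p` | ✓ | ✓ | ✓ | ✓ | ✓ `ν = ε⁻²` | ✗ reducible | ✓ `+1` | **(E) only** |
| `Sym² g_n ⊗ ψ`, `g_n` non-CM newforms of weight 2, prime-to-`p` level, big image | ✓ | ✗ | ✓ | ✓ | ✓ `ν = det⁻²`-type | ✓ (`p ≥ 11`) | ✓ | **(A) only** |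
| Artin `Γ_ℚ → GL₃(ℚ̄) ⊂ GL₃(ℚ̄_p)` | ✓ | some | ✓ | ✗ weights `{0,0,0}` | some | some | ✓ | (C2) |
| `Ind_K^ℚ θ`, `K` cubic, `θ` algebraic | ✓ | ✓ | ✓ | ✗ parallel weights `{a,a,a}` | – | – | – | (C2) |

Details for the second row (the informative one).  Characters of `Γ_ℚ` are linearly independent, so trace
identities become multiset identities.  PW: `{1, ε⁻¹, ε⁻²χ_m} = μ·{1, ε⁻¹, ε⁻²χ_n}` forces `μ = 1` (the other
two choices put a finite-order character equal to a non-zero power of `ε`), hence `χ_m = χ_n`.  (A): the dual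
has characters `{1, ε, ε²χ_n⁻¹}`; equality with `μ·{1, ε⁻¹, ε⁻²χ_n}` forces `μ ∈ {1, ε, ε²χ_n⁻¹}` and each case
forces `χ_n = 1` or an identity `ε^3 = χ_n^2` — impossible for `χ_n ≠ 1` of finite order.  (C): `1, ε⁻¹, ε⁻²χ_n`
are crystalline at `p` (`χ_n` unramified at `p`) of weights `0, 1, 2` in the convention `HT(ε) = {−1}`.  (D):
`χ_n ≡ 1 mod 𝔪` (order a power of `p`), so `tr ρ̄_n(σ) = 1 + ω̄⁻¹ + ω̄⁻² = ω̄⁻²(σ)·tr ρ̄_n(σ⁻¹)`.  (F):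
`tr ρ_n(c) = 1 + ε⁻¹(c) + ε⁻²(c)χ_n(c) = 1 − 1 + 1 = +1` (`χ_n` of odd order).  So WITHOUT (E) the crux holds
in the intended model by class field theory alone (and every ingredient — `ε`, Dirichlet avatars, block
sums — exists in the tree; only (C1) would remain uncertifiable, §2).  (E) is therefore the conjunct that
carries the entire "primitive rank-3 motive" content; any restatement must keep it (the route does: ACC+
needs it anyway).

## 5. Typing audit (read-back of the elaborated statement; no formal kill)

* `FramedGaloisRep ℚ (PadicAlgCl p) 3 = (absoluteGaloisGroup ℚ →ₜ* GL (Fin 3) ℚ̄_p)`; `PadicAlgCl p =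
  AlgebraicClosure ℚ_[p]` with Mathlib's spectral-norm `NormedField` (so `‖·‖ < 1` in (D) is "≡ mod 𝔪_{ℤ̄_p}"
  for the integral traces of a compact image — sound).
* PW/(A)/(D): `(χ σ).val 0 0` is the value of a rank-1 framed representation; `σ⁻¹`-traces encode duals
  correctly (Brauer–Nesbitt in characteristic 0 for semisimple `ρ`; for non-semisimple `ρ` the trace form is
  WEAKER than `ρ^∨ ≅ ρ ⊗ χ`, harmless in an `∃`-statement).
* (B): `IsUnramifiedAt v ρ = ∀ 𝔓 ∈ v.primesAbove, ∀ σ ∈ 𝔓.inertia Γ_ℚ, ρ σ = 1` (Mathlib `Ideal.inertia` on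
  the absolute integers) — genuine global inertia.
* (C): `fontainePstAdicCompletion v p hv = fontainePst ℚ_v p _`; `.algebra` = canonical (and ring maps
  `ℚ_p → ℚ_v` are unique anyway), `.𝔅 = bdRPeriodRingData` (Fontaine's `B_dR(ℚ_v)`, constructed) — both
  UNCONDITIONAL; `τ : ℚ_v →ₐ[ℚ_p] ℚ̄_p` exists and is unique, so `∀ τ` is neither vacuous nor wild;
  `labelledHodgeTateWeightsAt = jumpMultiset (i ↦ dim_{ℚ̄_p} (D_τ ∩ (ℚ̄_p³ ⊗ Fil^i B_dR)))` computed on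
  `ℚ̄_p³ ⊗_{ℚ_p} B_dR`; for a member with a finite model `V_L`, `D = ℚ̄_p ⊗_L D_dR(V_L)` has dimension 3 and the
  multiset `{0,1,2}` (`= insert 0 (insert 1 {2})`) is the regular Hodge type — reachable, not junk.  (C1) —
  see §2–§3.
* (E): `IsResiduallyAbsIrreducible` = some reduction over `ℤ̄_p/𝔪` (via an integral model `P⁻¹ρP ∈ GL₃(ℤ̄_p)`)
  is irreducible after every field extension `ℤ̄_p/𝔪 → k'` (`k' : Type`); applied to
  `ρ ∘ absGaloisRestrict ℚ ℚ(ζ_p)` (restriction along `IsAlgClosed.lift`, well defined up to conjugacy) —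
  genuine.
* (F): `IsComplexConjugation φ c` = `c` acts as complex conjugation under some `ι : ℚ̄ → ℂ` over `φ`; such `c`
  has order 2, `ρ(c)` is an involution of trace `∈ {±1, ±3}`; `±1` is Hodge symmetry for type `(1,1,1)`.
* Quantifier order matches the informal text; `11 ≤ p` only feeds AdjointLiftingGL3 (`p > n² = 9`).
* Degenerate parameters: none available (`p ≥ 11` prime; rank fixed; the family index set `ℕ` with PW
  excludes finite repetition).

## 6. Targets — line `birth` (PICKED)

* `stub_not_twistEquivalent_of_certificate` (landed p158189) and `stub_not_essSelfDual_of_certificate`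
  (landed p158260): TRUE — re-derived: from `tr ρ(g) = χ(g) tr ρ'(g)` at `g = σ, σ², σ³` the power sums of
  `M = ρ(σ)` are `s^k` times those of `M' = ρ'(σ)`, so Newton gives `e_j(M) = s^j e_j(M')`, whence
  `(tr M)³ det M' = (tr M')³ det M`; dually `e_j(M⁻¹) = s^j e_j(M)` gives `d⁻¹ = s³d`, `tr M⁻¹ = s·a`,
  `b := e₂(M) = d·tr M⁻¹ = s a d`, `b³ = s³a³d³ = a³d`, i.e. `((tr M)² − tr M²)³ = 8 (tr M)³ det M`.
  Not attackable.
* `stub_certifiedSeedFamily` (open core): contains clause (C) of the crux VERBATIM ⇒ §2–§3 apply word for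
  word (`advDatumAt` falsifies its `𝔇`-parametrised form mod the same H; the pinned form is undetermined);
  its extra finite certificates are generically satisfiable (Zariski-dense image of a primitive `ρ` violates
  the two polynomial identities somewhere), so stub 1 is not harder than the crux in the intended model.
* Joint sufficiency: `ExplicitRamifiedFamily_of` is kernel-checked and feeds each certificate to the landed
  stubs; no gap.

## 7. Reality-side status (why no mathematical kill is available)

* ONE member at `p = 11` is plausible from print: the Ash–Grayson–Green level-53 non-selfdual class (Hecke
  field `ℚ(√−11)`, `λ = (√−11)` conjugation-ramified over `p = 11 ≥ 11`): `r_ι(π)` (HLTT/Scholze) gives (A)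
  (non-selfdual class), (B), (C) in the intended model (level prime to 11, cohomological weight ⇒ crystalline
  with weights `{0,1,2}`), (D) by the route's lever (`ρ^c ≅ ρ^∨ε⁻²` and `c ≡ 1 mod λ`), (F) (Caraiani–Le Hung);
  (E) = irreducibility of the mod-`λ` reduction over `ℚ(ζ₁₁)` is UNVERIFIED (the route's kit job j019849
  probes the companion congruence).  Porat 2024 (levels 521, 953, 1289, 1433) supplies further isolated data.
* An INFINITE pairwise twist-inequivalent supply at ONE prime `p ≥ 11` has no source in print: van
  Geemen–Top's surfaces have `E = ℚ(i)` (conjugation-fixed primes: `(1+i)` and inert `p ≡ 3 (4)`, where the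
  reduction is CONJUGATE-self-dual over `𝔽_{p²}`, not self-dual — (D) fails generically); cubic inductions
  and symmetric squares are excluded by (C2)/(A).  The intended source (surfaces over `ℚ` with a ℚ-rational
  automorphism of order `p^k ≥ 11` and a rank-3 `(1,1,1)` eigenpiece) is an open algebro-geometric search
  (strategist: canonical surfaces `p_g = 10` in `ℙ⁹` with a ℚ-rational `ℤ/11`).
* No finiteness theorem applies: crystalline lifts of a fixed residual representation with FIXED conductor
  are finite in number, but the conductor of `f n` is free; heuristically non-self-dual cohomological forms on
  `GL₃/ℚ` are rare but infinite in number.  So `ArithmeticCore` is open and believed TRUE; a refutation of the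
  crux through its arithmetic is not to be expected.
* Barriers (`Literature/Barriers/Langlands/`): `FamilyWitnessConsecutiveWeights` (Griffiths transversality
  forces consecutive weights on family-built witnesses) does not bite — `{0,1,2}` is consecutive;
  `TwistedEndoscopySelfDual` / `ShimuraVarietyRealizationBarrier` concern automorphy and the construction of
  `r_ι(π)`, not the existence asserted here; `ResiduallyReducibleBarrier` is respected by (E).
-/

end Summit.Langlands.Langlands.Cruxes.ExplicitRamifiedFamily.Disproof

end
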